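import Summits.NavierStokesRegularity.NavierStokesRegularity.Theses.AdaptedFrequency
import Summits.NavierStokesRegularity.NavierStokesRegularity.Theses.RecurrentProfiles
import Summits.NavierStokesRegularity.NavierStokesRegularity.Theorems.AdaptedFrequencyAdaptedFrequencyConvergesOfMildHullRigidity
import Summits.NavierStokesRegularity.NavierStokesRegularity.Theorems.AdaptedFrequencyAdaptedFrequencyConvergesOfRecurrentLiouville
import Summits.NavierStokesRegularity.NavierStokesRegularity.Theorems.AdaptedFrequencyAdaptedFrequencyConvergesStubPinchedHullRecurrence
import Summits.NavierStokesRegularity.NavierStokesRegularity.Theorems.AdaptedFrequencyAdaptedFrequencyConvergesStubRecurrentPinchedBridge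
import Literature.Analysis.FluidPDE.AdaptedBackwardKernel
import Literature.Analysis.FluidPDE.TypeIAncientMild
import Literature.Analysis.FluidPDE.LocalTypeI
import Literature.Analysis.FluidPDE.SuitableWeak
import Literature.Analysis.FluidPDE.SelfSimilar

/-!
# Line `birkhoff-recurrent-hull` — skeleton for crux `AdaptedFrequencyConverges`
(stmt-NavierStokesRegularity-10493; crux-strategist / wall-breaker planner-cstrat-stmt-NavierStokesRegularity-10493-p1-0, 2026-08-17)

## v2 (lead prover-line-stmt-NavierStokesRegularity-10493-c4-0, 2026-08-17): the two soft stubs are tree theorems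
Taking the Birkhoff step on the blow-up's own local-energy profile instead of on its tangent PAIRS, both
soft stubs of v1 are already PROVED items of route RecurrentProfiles / RellichScar:
`typeIBlowupProfile_recurrentProfiles` (stmt-1591: a maximal classical Type-I blow-up generates an
origin-singular Albritton–Barker profile — the bridge), `recurrentReduction_proof` (stmt-1590: Birkhoff
recurrence on that class) and `recurrentProfiles_targetOfCruxes_proof` (stmt-1593, glue); with the vacuity
certificate `adaptedFrequencyConverges_of_noTypeIBlowup` (p121598) and the DEFINITION
`IsMaximalSmoothSolution = classical ∧ ¬HasSmoothExtensionPast` this gives, LANDED as p137229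
(`Theorems/AdaptedFrequencyAdaptedFrequencyConvergesOfRecurrentLiouville.lean`):
  `BirkhoffRecurrentHull.adaptedFrequencyConverges_of_recurrentLiouville : RecurrentLiouville → AdaptedFrequencyConverges`
  `BirkhoffRecurrentHull.noTypeIBlowup_of_noTypeIRateProfile : RecurrentProfiles.NoTypeIRateProfile → AdaptedFrequency.NoTypeIBlowup`.
So the LOAD-BEARING composition `AdaptedFrequencyConverges_of` below now has ONE antecedent, stub 3 =
stmt-NavierStokesRegularity-1589 verbatim, and the crux's ledger state is `blocked-on: stmt-1589` with nothing
else open. Stubs 1–2 are kept (registered, sorried) as the OPTIONAL hull-form strengthening: with them the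
crux needs 1589 only on uniformly recurrent PINCHED KERNEL-CARRYING mild pairs (composition
`AdaptedFrequencyConverges_of_hullForm`, the strategist's v1 composition verbatim); they are waved to
stub-workers and do not gate the crux.

## v3 (lead c4, wave 1 integrated, 2026-08-17T02:50Z): the hull-form stubs are LANDED
`stub_pinchedHullRecurrence` — p139254 (`Theorems/AdaptedFrequencyAdaptedFrequencyConvergesStubPinchedHullRecurrence.lean`;
helpers p138472 `…Kernel` = joint equicontinuity of adapted kernels of Type-I drifts on slab pieces, p139063 `…Orbit` =
class covariance + sequential compactness of the scaling orbit in both components; Birkhoff via `exists_isUniformlyRecurrentPt`);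
`stub_recurrentPinchedBridge` — p139191 (`…StubRecurrentPinchedBridge.lean`; helpers p138541 `…GradLedger` =
`farPast_gradLedger`, the E-ledger of the class A_C with dissipation kept, and p138625 `…L3` = C⁰ ⇒ L³_loc recurrence).
Below, stubs 1–2 are the landed theorems BY NAME; the only `sorry` left is stub 3 = stmt-1589. Both compositions
(`AdaptedFrequencyConverges_of`, `AdaptedFrequencyConverges_of_hullForm`) close the crux modulo stmt-1589 alone; the
hull form moreover shows crux ⇐ NoRecurrentPinchedPair ⇐ stmt-1589 (certificate file `…OfNoRecurrentPinchedPair.lean`).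

## Where the crux stands (input of this line)
Every previous line (tauberian-omega-limit, unsteadiness-squeeze, cloud-frame-effective-tsai) ends at the SAME
kernel-checked residue: by `CloudFrameEffectiveTsai.adaptedFrequencyConverges_of_pinchedMildHullHStationary`
(p119397) the crux at every viscosity follows from
  (HS)  every PINCHED unit-viscosity Type-I ancient MILD pair `(W, K)` — `W ∈ IsTypeIAncientMild C₀`, `K` the
        (unique) Gaussian-comparable adapted backward kernel of `W` on `(−∞,0)` with pole `(0,0)`,
        `c ≤ h̄(τ) := (−τ)²·adaptedEnstrophy W K τ ≤ C'` for all `τ < 0` — has `h̄` constant,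
and (HS) was only ever attacked as ONE undifferentiated Liouville statement, parked on `TypeIAncientLiouville`
(stmt-4050, certificate p121598).

## The lever: Birkhoff recurrence on the pinched hull — and the honest consequence (the crux is stmt-1589's)
The pinched class with fixed constants is invariant under the parabolic scalings `(W,K) ↦ (nsRescale l W, K_l)`,
`K_l(t,x) = l³K(l²t, lx)` (Type-I constant, pinching, Gaussian constants, kernel uniqueness are scale-invariant),
and sequentially COMPACT in `C⁰_loc((−∞,0)×ℝ³)` (KNSS 2009 Prop 4.1; kernel stability + uniqueness
`adaptedKernel_unique_typeI` p118532; pinching passes to limits p99329) — a compact metrizable dynamical system.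
Birkhoff 1927 / Gottschalk–Hedlund: a nonempty such system contains a UNIFORMLY RECURRENT point (tree:
`Literature.Dynamics.TopologicalDynamics.IsUniformlyRecurrentPt`, Furstenberg Thm 1.17 `MinimalOrbitClosure`
p132987; the same selection is PROVED for the local-energy Type-I class as `RecurrentProfiles.RecurrentReduction`,
stmt-1590, `recurrentReduction_proof`). Hence:
  stub 1 `stub_pinchedHullRecurrence`  — a pinched pair exists ⇒ a UNIFORMLY RECURRENT pinched pair exists (SOFT);
  stub 2 `stub_recurrentPinchedBridge`  — a uniformly recurrent pinched mild pair IS a profile of the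
        Albritton–Barker local-energy Type-I class (`𝐈 < ∞` by FarPastLedger stmt-14060 + the tree's cubic /
        pressure packages), uniformly recurrent in `L³_loc({t ≤ 0}×ℝ³)`, with a backward singular point at the
        origin (lower pinching ⇒ `curl W` unbounded at `(0,0)`) (SOFT, M);
  stub 3 `stub_recurrentLiouville`      — LETTER FOR LETTER the open item stmt-NavierStokesRegularity-1589
        `RecurrentProfiles.RecurrentLiouville` (crux #2 of routes RecurrentProfiles and SqueezeCycle): a uniformly
        recurrent local-energy Type-I profile is regular at the origin.
Composition (pure logic over p119397): the three stubs make (HS) hold VACUOUSLY, so the crux follows.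
WHAT THIS SAYS ABOUT THE CRUX. `AdaptedFrequencyConverges ⇐ RecurrentLiouville` (stmt-1589) modulo two provable
stubs — a strictly WEAKER and actively staffed upper bound than stmt-4050 ((L')), and the converse bridge already
exists on 1589's side (line Ideator5Round2Sketch of crux 1589, dead 2026-08-17T00:25Z: `RecurrentLiouville ⇐
[class form of THIS crux] ∧ FrequencyRigidity`, with the recurrence-upgrade lemmas p132655/p132685/p133011 landed).
Together: {stmt-10493 ∧ stmt-2955 (hull form)} and {stmt-1589 on kernel-carrying pinched profiles} are ONE
open problem — the Type-I recurrent-Liouville cluster {1589 ⟺ 11716 ∧ 11719 (p128754) ⇐ 4052 ≡ 4050 ⇐ 10661}.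
This skeleton is the 10493-side certificate of that identification; its two soft stubs are real theorems to land.

## Disproof used (Cruxes/AdaptedFrequencyConverges/Disproof.lean v3.1)
* `adaptedFrequencyConverges_false_without_decay`: the far-field input H (Leray–Hopf energy / decay / global sup in
  Type I) is spent INSIDE p119397 (lower pinching p82804 = Barker–Prange concentration + Type-I Morrey bound),
  through which the composition passes; stub 2 uses H again (FarPastLedger is a far-field ledger).
* Part I (`no_pinched_gaussian_kernel`, Negative/PinchedClock p83655): the linear bench carries no pinched comparable
  kernel, so it instantiates none of the three stubs.
* Negative/BandExclusionHiddenMonotonicity (p107589), SlowDecreaseOfCrux (p84273), LandauTightness (p83632): not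
  engaged (no sign of `Λ′`, no Tauberian step).  No `-- Targets` entry concerns recurrent pairs.

## Why it dodges the STUCK goal of the dead lines
The stuck goal (lead c3) was (HS) for ALL pinched pairs with "no engine: needs a Lyapunov functional on eternal
bounded Leray flows". Stubs 1–2 replace "eternal" by "uniformly recurrent" and move the residue VERBATIM onto an
existing, staffed item of another route; nothing G-local and no sign of `Λ′` is claimed. The line is COMPLETE
MODULO stmt-1589 by design (terminal state = that of 1589's own line: complete modulo 11716/11719).
-/

noncomputable section

-- the summit and its single problem share the name (D-0017 nested layout)
set_option linter.dupNamespace false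

namespace Summit.NavierStokesRegularity.NavierStokesRegularity.Cruxes.AdaptedFrequencyConverges.Lines.BirkhoffRecurrentHull

open scoped Topology ENNReal
open Literature.Analysis.FluidPDE Set Filter MeasureTheory Function
open Summit.NavierStokesRegularity.NavierStokesRegularity.Theses.AdaptedFrequency

/-! ## Stubs (registered; prove EXACTLY these signatures, `--supports stmt-NavierStokesRegularity-10493`)

Vocabulary (tree declarations only; everything else inlined):
* PINCHED PAIR `(C₀, c, C', W, K)`: verbatim the hypothesis list of
  `adaptedFrequencyConverges_of_pinchedMildHullHStationary` (p119397).
* UNIFORMLY RECURRENT PAIR (parabolic scaling about `(0,0)`, `C⁰` on compact cylinders):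
  `∀ ε > 0, ∀ R > 1, ∃ L > 1, ∀ a > 0, ∃ l ∈ [a, L·a], ∀ (t,x), −R ≤ t ≤ −R⁻¹, ‖x‖ ≤ R →
     ‖nsRescale l W t x − W t x‖ ≤ ε ∧ |l³K(l²t, l x) − K(t,x)| ≤ ε`
  (every multiplicative window of scales contains a return of the rescaled PAIR; `l = 1` is the trivial return). -/

/-- **Stub 1 — Birkhoff recurrence on the pinched hull** (LANDED p139254, wave 1 of lead c4; was: SOFT, M–L).
If some pinched unit-viscosity Type-I ancient mild pair exists, a UNIFORMLY RECURRENT one exists (possibly with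
other constants). Proof sketch: fix the Type-I / pinching / Gaussian constants of the given pair; the class of
pinched pairs with these constants is nonempty, invariant under `(W,K) ↦ (nsRescale l W, l³K(l²·, l·))`, `l > 0`
(`IsTypeIAncientMild` keeps `C₀`; kernel clauses, comparability constants and uniqueness are scale-covariant —
tree `Theorems/AdaptedFrequencyTangentFlowTransferDilation`, `…ConvergesStubHullTransferZoom`; and
`(−t)²·adaptedEnstrophy (nsRescale l W) K_l t = h̄(l²t)`), and sequentially compact for `C⁰_loc`-convergence of
both components with limits in the class (`Literature.Analysis.FluidPDE.AncientMildCompactness` / KNSS Prop 4.1;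
kernel compactness + stability as in `hullTransfer_mild_unit` p119397; limit-kernel uniqueness
`adaptedKernel_unique_typeI` p118532; pinching in the limit `hullTransfer_tendsto_enstrophy_frequency` p99329).
`C⁰_loc` on the class is metrizable (countable exhaustion by cylinders) and the `(ℝ,+)`-action
`σ ↦ (·)_{exp σ}` is jointly continuous, so a minimal closed invariant subset exists (Zorn; Mathlib
`IsClosed.exists_minimal_nonempty_closed_subset` as used in `recurrentReduction_proof`) and its points are uniformly
recurrent (`Literature.Dynamics.TopologicalDynamics.IsUniformlyRecurrentPt`; Mathlib
`IsCompact.exists_finite_cover_smul`); unwinding the neighbourhood basis gives the displayed clause.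
[Birkhoff 1927 Ch. VII §2; Furstenberg 1981 Def 1.8, Thms 1.15–1.17; KNSS 2009 arXiv:0709.3599 Prop 4.1;
in-tree precedent: stmt-1590 `recurrentReduction_proof`] -/
theorem stub_pinchedHullRecurrence :
    (∃ (C₀ c C' : ℝ) (W : ℝ → EuclideanSpace ℝ (Fin 3) → EuclideanSpace ℝ (Fin 3))
        (K : ℝ → EuclideanSpace ℝ (Fin 3) → ℝ),
      0 ≤ C₀ ∧ 0 < c ∧ IsTypeIAncientMild C₀ W ∧ IsAdaptedBackwardKernel 1 W (Iio 0) 0 0 K ∧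
        IsGaussianComparable K (Iio 0) 0 0 ∧
        (∀ K' : ℝ → EuclideanSpace ℝ (Fin 3) → ℝ, IsAdaptedBackwardKernel 1 W (Iio 0) 0 0 K' →
          IsGaussianComparable K' (Iio 0) 0 0 → ∀ t ∈ Iio (0:ℝ), K' t = K t) ∧
        (∀ τ ∈ Iio (0:ℝ), c ≤ (-τ) ^ 2 * adaptedEnstrophy W K τ ∧
          (-τ) ^ 2 * adaptedEnstrophy W K τ ≤ C')) →
    ∃ (C₀ c C' : ℝ) (W : ℝ → EuclideanSpace ℝ (Fin 3) → EuclideanSpace ℝ (Fin 3))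
        (K : ℝ → EuclideanSpace ℝ (Fin 3) → ℝ),
      (0 ≤ C₀ ∧ 0 < c ∧ IsTypeIAncientMild C₀ W ∧ IsAdaptedBackwardKernel 1 W (Iio 0) 0 0 K ∧
        IsGaussianComparable K (Iio 0) 0 0 ∧
        (∀ K' : ℝ → EuclideanSpace ℝ (Fin 3) → ℝ, IsAdaptedBackwardKernel 1 W (Iio 0) 0 0 K' →
          IsGaussianComparable K' (Iio 0) 0 0 → ∀ t ∈ Iio (0:ℝ), K' t = K t) ∧
        (∀ τ ∈ Iio (0:ℝ), c ≤ (-τ) ^ 2 * adaptedEnstrophy W K τ ∧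
          (-τ) ^ 2 * adaptedEnstrophy W K τ ≤ C')) ∧
      (∀ ε : ℝ, 0 < ε → ∀ R : ℝ, 1 < R → ∃ L : ℝ, 1 < L ∧ ∀ a : ℝ, 0 < a → ∃ l : ℝ, a ≤ l ∧ l ≤ L * a ∧
        ∀ (t : ℝ) (x : EuclideanSpace ℝ (Fin 3)), -R ≤ t → t ≤ -R⁻¹ → ‖x‖ ≤ R →
          ‖nsRescale l W t x - W t x‖ ≤ ε ∧ |l ^ 3 * K (l ^ 2 * t) (l • x) - K t x| ≤ ε) :=
  Summit.NavierStokesRegularity.NavierStokesRegularity.Theorems.AdaptedFrequencyConverges.BirkhoffRecurrentHull.stub_pinchedHullRecurrence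

/-- **Stub 2 — bridge: a uniformly recurrent pinched mild pair is a recurrent local-energy Type-I profile,
singular at the origin** (LANDED p139191, wave 1 of lead c4; was: SOFT, M). For `(W, K)` pinched and uniformly recurrent (pair, `C⁰`):
(i) `W` is smooth on the open slab, hence a suitable weak solution there with some pressure `p` (the KNSS pressure
`RᵢRⱼ(WᵢWⱼ)`, cf. the `∃ q, IsClassicalNSSolutionOn (Iio 0) 1 0 W q` clause output by `hullTransfer_mild_unit`) and
weak gradient `G = fderiv`; (ii) `typeIBound (slab) W p G < ⊤`: `A` by FarPastLedger (stmt-14060 PROVED,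
`∫_{B_R}|W(t)|² ≤ K(C₀)R`, all centres by translation invariance of `A_{C₀}`), `C` by interpolation with the rate
(`setIntegral_norm_pow_three_le`, `integral_inv_sqrt_neg_le`, `cknC_le_of_ledger` of
`SymmetryModuliCountAxisymEndLiouvilleOfFarPastLedgerCubic`), `D` by the pressure package
(`pressurePackage_of_nearFar`), `E` by the local energy inequality; (iii) `HasTypeITimeDecay C₀ W` is a field of
`IsTypeIAncientMild`; (iv) `L³_loc({t ≤ 0})`-recurrence from the `C⁰` pair-recurrence on cylinders plus the
UNIFORM smallness `∫_{−δ}^{0}∫_{B_R}|u|³ ≤ 2C₀K R √δ` over the class (thin final slab); (v) backward singular point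
at `0`: if `W` were essentially bounded on some `Q_r(0,0)` then `curl W` is bounded near the origin for late times and
the Gaussian tails of `K` give `h̄(τ) → 0` as `τ ↑ 0`, contradicting `c ≤ h̄`. [AlbrittonBarker2019 arXiv:1811.00502
Lemma 2.6, Rem 3.2; KNSS 2009 §4; in-tree FarPastLedger stmt-14060] -/
theorem stub_recurrentPinchedBridge :
    ∀ (C₀ c C' : ℝ) (W : ℝ → EuclideanSpace ℝ (Fin 3) → EuclideanSpace ℝ (Fin 3))
      (K : ℝ → EuclideanSpace ℝ (Fin 3) → ℝ), 0 ≤ C₀ → 0 < c → IsTypeIAncientMild C₀ W →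
      IsAdaptedBackwardKernel 1 W (Iio 0) 0 0 K → IsGaussianComparable K (Iio 0) 0 0 →
      (∀ K' : ℝ → EuclideanSpace ℝ (Fin 3) → ℝ, IsAdaptedBackwardKernel 1 W (Iio 0) 0 0 K' →
        IsGaussianComparable K' (Iio 0) 0 0 → ∀ t ∈ Iio (0:ℝ), K' t = K t) →
      (∀ τ ∈ Iio (0:ℝ), c ≤ (-τ) ^ 2 * adaptedEnstrophy W K τ ∧ (-τ) ^ 2 * adaptedEnstrophy W K τ ≤ C') →
      (∀ ε : ℝ, 0 < ε → ∀ R : ℝ, 1 < R → ∃ L : ℝ, 1 < L ∧ ∀ a : ℝ, 0 < a → ∃ l : ℝ, a ≤ l ∧ l ≤ L * a ∧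
        ∀ (t : ℝ) (x : EuclideanSpace ℝ (Fin 3)), -R ≤ t → t ≤ -R⁻¹ → ‖x‖ ≤ R →
          ‖nsRescale l W t x - W t x‖ ≤ ε ∧ |l ^ 3 * K (l ^ 2 * t) (l • x) - K t x| ≤ ε) →
      ∃ (p : ℝ → EuclideanSpace ℝ (Fin 3) → ℝ) (G : ℝ → EuclideanSpace ℝ (Fin 3) → EuclideanSpace ℝ (Fin 3) →L[ℝ] EuclideanSpace ℝ (Fin 3)) (C : ℝ),
        IsSuitableWeakSolutionOn (slab (EuclideanSpace ℝ (Fin 3)) (Set.Iio 0) isOpen_Iio) 1 0 W p ∧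
        HasWeakSpatialGradientOn (slab (EuclideanSpace ℝ (Fin 3)) (Set.Iio 0) isOpen_Iio) W G ∧
        typeIBound (Set.Iio (0 : ℝ) ×ˢ Set.univ) W p G < ⊤ ∧ HasTypeITimeDecay C W ∧
        (∀ ε : ℝ, 0 < ε → ∀ K₁ : Set (ℝ × EuclideanSpace ℝ (Fin 3)), IsCompact K₁ → K₁ ⊆ Set.Iic (0 : ℝ) ×ˢ Set.univ →
          ∃ L : ℝ, 0 < L ∧ ∀ a : ℝ, ∃ σ ∈ Set.Icc a (a + L),
            MeasureTheory.eLpNorm (fun z : ℝ × EuclideanSpace ℝ (Fin 3) => nsRescale (Real.exp σ) W z.1 z.2 - W z.1 z.2) 3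
              (MeasureTheory.volume.restrict K₁) ≤ ENNReal.ofReal ε) ∧
        IsBackwardSingularPoint W 0 :=
  Summit.NavierStokesRegularity.NavierStokesRegularity.Theorems.AdaptedFrequencyConverges.BirkhoffRecurrentHull.stub_recurrentPinchedBridge

/-- **Stub 3 — RECURRENT LIOUVILLE = item stmt-NavierStokesRegularity-1589, letter for letter**
(`Theses.RecurrentProfiles.RecurrentLiouville`, crux #2 of route RecurrentProfiles, shared by route SqueezeCycle;
`stub_recurrentLiouville_iff` below is `Iff.rfl`). A uniformly recurrent (Birkhoff almost periodic under the NS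
scaling, in `L³_loc({t ≤ 0} × ℝ³)`) profile of the Albritton–Barker local-energy Type-I class with the Type-I rate is
REGULAR at the space–time origin. This is the irreducible open kernel: its hypothesis class contains every Type-I
λ-DSS / RDSS / RSS profile and the new quasi-periodic and weakly-mixing minimal sets; settled rungs: fixed points
(NRŠ 1996, Tsai 1998, in tree), λ ∈ (1, λ*(C)) (Chae–Wolf 2017 Thm 1.3; tree `…NearIdentityDSS/RDSS`), axisymmetric
(Seregin–Šverák 2009; tree `…NearAxisymmetricRemoval`), `L³` profiles (Chae 2015 Thm 1.2). Status on its own chain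
(2026-08-17): lines dead at stubs ≡ items 11716 `NoApexTypeIProfile` ∧ 11719 `ApexLocalisation` of route
RellichScar (glue p128754); strategist split of 1589 into those two filed. DO NOT attack it here: prove stubs 1–2
and land `AdaptedFrequencyConverges_of_recurrentLiouville` as the certificate; the crux then closes the day 1589 does.
[BradshawTsai2017CPDE OP 5.1; ChaeWolf2017RemovingDSS Thm 1.3; PineauVicol2026 Thms 1.4, 1.9; Furstenberg1981 Def 1.8] -/
theorem stub_recurrentLiouville :
    ∀ (u : ℝ → EuclideanSpace ℝ (Fin 3) → EuclideanSpace ℝ (Fin 3)) (p : ℝ → EuclideanSpace ℝ (Fin 3) → ℝ) (G : ℝ → EuclideanSpace ℝ (Fin 3) → EuclideanSpace ℝ (Fin 3) →L[ℝ] EuclideanSpace ℝ (Fin 3)) (C : ℝ), Literature.Analysis.FluidPDE.IsSuitableWeakSolutionOn (Literature.Analysis.FluidPDE.slab (EuclideanSpace ℝ (Fin 3)) (Set.Iio 0) isOpen_Iio) 1 0 u p → Literature.Analysis.FluidPDE.HasWeakSpatialGradientOn (Literature.Analysis.FluidPDE.slab (EuclideanSpace ℝ (Fin 3)) (Set.Iio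 0) isOpen_Iio) u G → Literature.Analysis.FluidPDE.typeIBound (Set.Iio (0 : ℝ) ×ˢ Set.univ) u p G < ⊤ → Literature.Analysis.FluidPDE.HasTypeITimeDecay C u → (∀ ε : ℝ, 0 < ε → ∀ K : Set (ℝ × EuclideanSpace ℝ (Fin 3)), IsCompact K → K ⊆ Set.Iic (0 : ℝ) ×ˢ Set.univ → ∃ L : ℝ, 0 < L ∧ ∀ a : ℝ, ∃ σ ∈ Set.Icc a (a + L), MeasureTheory.eLpNorm (fun z : ℝ × EuclideanSpace ℝ (Fin 3) => Literature.Analysis.FluidPDE.nsRescale (Real.exp σ) u z.1 z.2 - u z.1 z.2) 3 (MeasureTheory.volume.restrict K) ≤ ENNReal.ofReal ε) → ¬ Literature.Analysis.FluidPDE.IsBackwardSingularPoint u 0 := by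
  sorry

/-- The third stub is LETTER FOR LETTER the open item stmt-NavierStokesRegularity-1589
(`Theses.RecurrentProfiles.RecurrentLiouville`, crux #2 of route RecurrentProfiles, shared with route
SqueezeCycle): definitional check. -/
theorem stub_recurrentLiouville_iff :
    (∀ (u : ℝ → EuclideanSpace ℝ (Fin 3) → EuclideanSpace ℝ (Fin 3)) (p : ℝ → EuclideanSpace ℝ (Fin 3) → ℝ) (G : ℝ → EuclideanSpace ℝ (Fin 3) → EuclideanSpace ℝ (Fin 3) →L[ℝ] EuclideanSpace ℝ (Fin 3)) (C : ℝ), Literature.Analysis.FluidPDE.IsSuitableWeakSolutionOn (Literature.Analysis.FluidPDE.slab (EuclideanSpace ℝ (Fin 3)) (Set.Iio 0) isOpen_Iio) 1 0 u p → Literature.Analysis.FluidPDE.HasWeakSpatialGradientOn (Literature.Analysis.FluidPDE.slab (EuclideanSpace ℝ (Fin 3)) (Set.Iio 0) isOpen_Iio) u G → Literature.Analysis.FluidPDE.typeIBound (Set.Iio (0 : ℝ) ×ˢ Set.univ) u p G < ⊤ → Literature.Analysis.FluidPDE.HasTypeITimeDecay C u → (∀ ε : ℝ, 0 < ε → ∀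 K : Set (ℝ × EuclideanSpace ℝ (Fin 3)), IsCompact K → K ⊆ Set.Iic (0 : ℝ) ×ˢ Set.univ → ∃ L : ℝ, 0 < L ∧ ∀ a : ℝ, ∃ σ ∈ Set.Icc a (a + L), MeasureTheory.eLpNorm (fun z : ℝ × EuclideanSpace ℝ (Fin 3) => Literature.Analysis.FluidPDE.nsRescale (Real.exp σ) u z.1 z.2 - u z.1 z.2) 3 (MeasureTheory.volume.restrict K) ≤ ENNReal.ofReal ε) → ¬ Literature.Analysis.FluidPDE.IsBackwardSingularPoint u 0) ↔
    Summit.NavierStokesRegularity.NavierStokesRegularity.Theses.RecurrentProfiles.RecurrentLiouville :=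
  Iff.rfl

/-! ## Composition (sorry-free; the three stub STATEMENTS as antecedents; concludes the crux BY NAME) -/

/-- **The line closes the crux (v2, load-bearing composition): ONE antecedent, stub 3 = stmt-1589 verbatim.**
`RecurrentLiouville ⟹ NoTypeIRateProfile` (PROVED reduction stmt-1590 + glue stmt-1593) `⟹ NoTypeIBlowup`
(PROVED profile extraction stmt-1591; `IsMaximalSmoothSolution` is classical ∧ no extension) `⟹` the crux
(vacuity certificate p121598) — all by name through the landed certificate p137229. -/
theorem AdaptedFrequencyConverges_of
    (h3 : ∀ (u : ℝ → EuclideanSpace ℝ (Fin 3) → EuclideanSpace ℝ (Fin 3)) (p : ℝ → EuclideanSpace ℝ (Fin 3) → ℝ) (G : ℝ → EuclideanSpace ℝ (Fin 3) → EuclideanSpace ℝ (Fin 3) →L[ℝ] EuclideanSpace ℝ (Fin 3)) (C : ℝ), Literature.Analysis.FluidPDE.IsSuitableWeakSolutionOn (Literature.Analysis.FluidPDE.slab (EuclideanSpace ℝ (Fin 3)) (Set.Iio 0) isOpen_Iio) 1 0 u p → Literature.Analysis.FluidPDE.HasWeakSpatialGradientOn (Literature.Analysis.FluidPDE.slab (EuclideanSpace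 ℝ (Fin 3)) (Set.Iio 0) isOpen_Iio) u G → Literature.Analysis.FluidPDE.typeIBound (Set.Iio (0 : ℝ) ×ˢ Set.univ) u p G < ⊤ → Literature.Analysis.FluidPDE.HasTypeITimeDecay C u → (∀ ε : ℝ, 0 < ε → ∀ K : Set (ℝ × EuclideanSpace ℝ (Fin 3)), IsCompact K → K ⊆ Set.Iic (0 : ℝ) ×ˢ Set.univ → ∃ L : ℝ, 0 < L ∧ ∀ a : ℝ, ∃ σ ∈ Set.Icc a (a + L), MeasureTheory.eLpNorm (fun z : ℝ × EuclideanSpace ℝ (Fin 3) => Literature.Analysis.FluidPDE.nsRescale (Real.exp σ) u z.1 z.2 - u z.1 z.2) 3 (MeasureTheory.volume.restrict K) ≤ ENNReal.ofReal ε) → ¬ Literature.Analysis.FluidPDE.IsBackwardSingularPoint u 0) :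
    AdaptedFrequencyConverges :=
  Summit.NavierStokesRegularity.NavierStokesRegularity.Theorems.AdaptedFrequencyConverges.BirkhoffRecurrentHull.adaptedFrequencyConverges_of_recurrentLiouville
    (stub_recurrentLiouville_iff.1 h3)

/-- **Hull-form composition (the strategist's v1 composition, verbatim; OPTIONAL in v2).** Given the three stubs, the h-stationarity hypothesis (HS) of the landed reduction
`adaptedFrequencyConverges_of_pinchedMildHullHStationary` (p119397) holds VACUOUSLY: any pinched pair yields
(stub 1) a uniformly recurrent pinched pair, which (stub 2) is a uniformly recurrent local-energy Type-I profile
singular at the origin, which (stub 3 = stmt-1589) does not exist. Pure logic on top of p119397. -/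
theorem AdaptedFrequencyConverges_of_hullForm :
    ((∃ (C₀ c C' : ℝ) (W : ℝ → EuclideanSpace ℝ (Fin 3) → EuclideanSpace ℝ (Fin 3))
        (K : ℝ → EuclideanSpace ℝ (Fin 3) → ℝ),
      0 ≤ C₀ ∧ 0 < c ∧ IsTypeIAncientMild C₀ W ∧ IsAdaptedBackwardKernel 1 W (Iio 0) 0 0 K ∧
        IsGaussianComparable K (Iio 0) 0 0 ∧
        (∀ K' : ℝ → EuclideanSpace ℝ (Fin 3) → ℝ, IsAdaptedBackwardKernel 1 W (Iio 0) 0 0 K' →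
          IsGaussianComparable K' (Iio 0) 0 0 → ∀ t ∈ Iio (0:ℝ), K' t = K t) ∧
        (∀ τ ∈ Iio (0:ℝ), c ≤ (-τ) ^ 2 * adaptedEnstrophy W K τ ∧
          (-τ) ^ 2 * adaptedEnstrophy W K τ ≤ C')) →
    ∃ (C₀ c C' : ℝ) (W : ℝ → EuclideanSpace ℝ (Fin 3) → EuclideanSpace ℝ (Fin 3))
        (K : ℝ → EuclideanSpace ℝ (Fin 3) → ℝ),
      (0 ≤ C₀ ∧ 0 < c ∧ IsTypeIAncientMild C₀ W ∧ IsAdaptedBackwardKernel 1 W (Iio 0) 0 0 K ∧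
        IsGaussianComparable K (Iio 0) 0 0 ∧
        (∀ K' : ℝ → EuclideanSpace ℝ (Fin 3) → ℝ, IsAdaptedBackwardKernel 1 W (Iio 0) 0 0 K' →
          IsGaussianComparable K' (Iio 0) 0 0 → ∀ t ∈ Iio (0:ℝ), K' t = K t) ∧
        (∀ τ ∈ Iio (0:ℝ), c ≤ (-τ) ^ 2 * adaptedEnstrophy W K τ ∧
          (-τ) ^ 2 * adaptedEnstrophy W K τ ≤ C')) ∧
      (∀ ε : ℝ, 0 < ε → ∀ R : ℝ, 1 < R → ∃ L : ℝ, 1 < L ∧ ∀ a : ℝ, 0 < a → ∃ l : ℝ, a ≤ l ∧ l ≤ L * a ∧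
        ∀ (t : ℝ) (x : EuclideanSpace ℝ (Fin 3)), -R ≤ t → t ≤ -R⁻¹ → ‖x‖ ≤ R →
          ‖nsRescale l W t x - W t x‖ ≤ ε ∧ |l ^ 3 * K (l ^ 2 * t) (l • x) - K t x| ≤ ε)) →
    (∀ (C₀ c C' : ℝ) (W : ℝ → EuclideanSpace ℝ (Fin 3) → EuclideanSpace ℝ (Fin 3))
      (K : ℝ → EuclideanSpace ℝ (Fin 3) → ℝ), 0 ≤ C₀ → 0 < c → IsTypeIAncientMild C₀ W →
      IsAdaptedBackwardKernel 1 W (Iio 0) 0 0 K → IsGaussianComparable K (Iio 0) 0 0 →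
      (∀ K' : ℝ → EuclideanSpace ℝ (Fin 3) → ℝ, IsAdaptedBackwardKernel 1 W (Iio 0) 0 0 K' →
        IsGaussianComparable K' (Iio 0) 0 0 → ∀ t ∈ Iio (0:ℝ), K' t = K t) →
      (∀ τ ∈ Iio (0:ℝ), c ≤ (-τ) ^ 2 * adaptedEnstrophy W K τ ∧ (-τ) ^ 2 * adaptedEnstrophy W K τ ≤ C') →
      (∀ ε : ℝ, 0 < ε → ∀ R : ℝ, 1 < R → ∃ L : ℝ, 1 < L ∧ ∀ a : ℝ, 0 < a → ∃ l : ℝ, a ≤ l ∧ l ≤ L * a ∧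
        ∀ (t : ℝ) (x : EuclideanSpace ℝ (Fin 3)), -R ≤ t → t ≤ -R⁻¹ → ‖x‖ ≤ R →
          ‖nsRescale l W t x - W t x‖ ≤ ε ∧ |l ^ 3 * K (l ^ 2 * t) (l • x) - K t x| ≤ ε) →
      ∃ (p : ℝ → EuclideanSpace ℝ (Fin 3) → ℝ) (G : ℝ → EuclideanSpace ℝ (Fin 3) → EuclideanSpace ℝ (Fin 3) →L[ℝ] EuclideanSpace ℝ (Fin 3)) (C : ℝ),
        IsSuitableWeakSolutionOn (slab (EuclideanSpace ℝ (Fin 3)) (Set.Iio 0) isOpen_Iio) 1 0 W p ∧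
        HasWeakSpatialGradientOn (slab (EuclideanSpace ℝ (Fin 3)) (Set.Iio 0) isOpen_Iio) W G ∧
        typeIBound (Set.Iio (0 : ℝ) ×ˢ Set.univ) W p G < ⊤ ∧ HasTypeITimeDecay C W ∧
        (∀ ε : ℝ, 0 < ε → ∀ K₁ : Set (ℝ × EuclideanSpace ℝ (Fin 3)), IsCompact K₁ → K₁ ⊆ Set.Iic (0 : ℝ) ×ˢ Set.univ →
          ∃ L : ℝ, 0 < L ∧ ∀ a : ℝ, ∃ σ ∈ Set.Icc a (a + L),
            MeasureTheory.eLpNorm (fun z : ℝ × EuclideanSpace ℝ (Fin 3) => nsRescale (Real.exp σ) W z.1 z.2 - W z.1 z.2) 3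
              (MeasureTheory.volume.restrict K₁) ≤ ENNReal.ofReal ε) ∧
        IsBackwardSingularPoint W 0) →
    (∀ (u : ℝ → EuclideanSpace ℝ (Fin 3) → EuclideanSpace ℝ (Fin 3)) (p : ℝ → EuclideanSpace ℝ (Fin 3) → ℝ) (G : ℝ → EuclideanSpace ℝ (Fin 3) → EuclideanSpace ℝ (Fin 3) →L[ℝ] EuclideanSpace ℝ (Fin 3)) (C : ℝ), Literature.Analysis.FluidPDE.IsSuitableWeakSolutionOn (Literature.Analysis.FluidPDE.slab (EuclideanSpace ℝ (Fin 3)) (Set.Iio 0) isOpen_Iio) 1 0 u p → Literature.Analysis.FluidPDE.HasWeakSpatialGradientOn (Literature.Analysis.FluidPDE.slab (EuclideanSpace ℝ (Fin 3)) (Set.Iio 0) isOpen_Iio) u G → Literature.Analysis.FluidPDE.typeIBound (Set.Iio (0 : ℝ) ×ˢ Set.univ) u p G < ⊤ → Literature.Analysis.FluidPDE.HasTypeITimeDecay C u → (∀ ε : ℝ, 0 < ε → ∀ K : Set (ℝ × EuclideanSpace ℝ (Fin 3)), IsCompact K → K ⊆ Set.Iic (0 : ℝ) ×ˢ Set.univ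 → ∃ L : ℝ, 0 < L ∧ ∀ a : ℝ, ∃ σ ∈ Set.Icc a (a + L), MeasureTheory.eLpNorm (fun z : ℝ × EuclideanSpace ℝ (Fin 3) => Literature.Analysis.FluidPDE.nsRescale (Real.exp σ) u z.1 z.2 - u z.1 z.2) 3 (MeasureTheory.volume.restrict K) ≤ ENNReal.ofReal ε) → ¬ Literature.Analysis.FluidPDE.IsBackwardSingularPoint u 0) →
    AdaptedFrequencyConverges := by
  intro h1 h2 h3
  refine Summit.NavierStokesRegularity.NavierStokesRegularity.Theorems.AdaptedFrequencyConverges.CloudFrameEffectiveTsai.adaptedFrequencyConverges_of_pinchedMildHullHStationary ?_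
  intro C₀ c C' W K hC₀ hc hW hK hG huniq hpinch τ₁ τ₂ hτ₁ hτ₂
  exfalso
  obtain ⟨C₀', c', C'', W', K', ⟨hC₀', hc', hW', hK', hG', huniq', hpinch'⟩, hrec⟩ :=
    h1 ⟨C₀, c, C', W, K, hC₀, hc, hW, hK, hG, huniq, hpinch⟩
  obtain ⟨p, G, C, hsw, hgr, hI, hdec, hL3, hsing⟩ :=
    h2 C₀' c' C'' W' K' hC₀' hc' hW' hK' hG' huniq' hpinch' hrec
  exact h3 W' p G C hsw hgr hI hdec hL3 hsing

/-- **The crux from the EXISTING item stmt-1589 alone, modulo the two soft stubs** — the certificate a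
prover lands the day stubs 1–2 close: `AdaptedFrequencyConverges ⇐ RecurrentLiouville`. -/
theorem AdaptedFrequencyConverges_of_recurrentLiouville
    (h1 : (∃ (C₀ c C' : ℝ) (W : ℝ → EuclideanSpace ℝ (Fin 3) → EuclideanSpace ℝ (Fin 3))
        (K : ℝ → EuclideanSpace ℝ (Fin 3) → ℝ),
      0 ≤ C₀ ∧ 0 < c ∧ IsTypeIAncientMild C₀ W ∧ IsAdaptedBackwardKernel 1 W (Iio 0) 0 0 K ∧
        IsGaussianComparable K (Iio 0) 0 0 ∧
        (∀ K' : ℝ → EuclideanSpace ℝ (Fin 3) → ℝ, IsAdaptedBackwardKernel 1 W (Iio 0) 0 0 K' →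
          IsGaussianComparable K' (Iio 0) 0 0 → ∀ t ∈ Iio (0:ℝ), K' t = K t) ∧
        (∀ τ ∈ Iio (0:ℝ), c ≤ (-τ) ^ 2 * adaptedEnstrophy W K τ ∧
          (-τ) ^ 2 * adaptedEnstrophy W K τ ≤ C')) →
    ∃ (C₀ c C' : ℝ) (W : ℝ → EuclideanSpace ℝ (Fin 3) → EuclideanSpace ℝ (Fin 3))
        (K : ℝ → EuclideanSpace ℝ (Fin 3) → ℝ),
      (0 ≤ C₀ ∧ 0 < c ∧ IsTypeIAncientMild C₀ W ∧ IsAdaptedBackwardKernel 1 W (Iio 0) 0 0 K ∧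
        IsGaussianComparable K (Iio 0) 0 0 ∧
        (∀ K' : ℝ → EuclideanSpace ℝ (Fin 3) → ℝ, IsAdaptedBackwardKernel 1 W (Iio 0) 0 0 K' →
          IsGaussianComparable K' (Iio 0) 0 0 → ∀ t ∈ Iio (0:ℝ), K' t = K t) ∧
        (∀ τ ∈ Iio (0:ℝ), c ≤ (-τ) ^ 2 * adaptedEnstrophy W K τ ∧
          (-τ) ^ 2 * adaptedEnstrophy W K τ ≤ C')) ∧
      (∀ ε : ℝ, 0 < ε → ∀ R : ℝ, 1 < R → ∃ L : ℝ, 1 < L ∧ ∀ a : ℝ, 0 < a → ∃ l : ℝ, a ≤ l ∧ l ≤ L * a ∧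
        ∀ (t : ℝ) (x : EuclideanSpace ℝ (Fin 3)), -R ≤ t → t ≤ -R⁻¹ → ‖x‖ ≤ R →
          ‖nsRescale l W t x - W t x‖ ≤ ε ∧ |l ^ 3 * K (l ^ 2 * t) (l • x) - K t x| ≤ ε))
    (h2 : ∀ (C₀ c C' : ℝ) (W : ℝ → EuclideanSpace ℝ (Fin 3) → EuclideanSpace ℝ (Fin 3))
      (K : ℝ → EuclideanSpace ℝ (Fin 3) → ℝ), 0 ≤ C₀ → 0 < c → IsTypeIAncientMild C₀ W →
      IsAdaptedBackwardKernel 1 W (Iio 0) 0 0 K → IsGaussianComparable K (Iio 0) 0 0 →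
      (∀ K' : ℝ → EuclideanSpace ℝ (Fin 3) → ℝ, IsAdaptedBackwardKernel 1 W (Iio 0) 0 0 K' →
        IsGaussianComparable K' (Iio 0) 0 0 → ∀ t ∈ Iio (0:ℝ), K' t = K t) →
      (∀ τ ∈ Iio (0:ℝ), c ≤ (-τ) ^ 2 * adaptedEnstrophy W K τ ∧ (-τ) ^ 2 * adaptedEnstrophy W K τ ≤ C') →
      (∀ ε : ℝ, 0 < ε → ∀ R : ℝ, 1 < R → ∃ L : ℝ, 1 < L ∧ ∀ a : ℝ, 0 < a → ∃ l : ℝ, a ≤ l ∧ l ≤ L * a ∧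
        ∀ (t : ℝ) (x : EuclideanSpace ℝ (Fin 3)), -R ≤ t → t ≤ -R⁻¹ → ‖x‖ ≤ R →
          ‖nsRescale l W t x - W t x‖ ≤ ε ∧ |l ^ 3 * K (l ^ 2 * t) (l • x) - K t x| ≤ ε) →
      ∃ (p : ℝ → EuclideanSpace ℝ (Fin 3) → ℝ) (G : ℝ → EuclideanSpace ℝ (Fin 3) → EuclideanSpace ℝ (Fin 3) →L[ℝ] EuclideanSpace ℝ (Fin 3)) (C : ℝ),
        IsSuitableWeakSolutionOn (slab (EuclideanSpace ℝ (Fin 3)) (Set.Iio 0) isOpen_Iio) 1 0 W p ∧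
        HasWeakSpatialGradientOn (slab (EuclideanSpace ℝ (Fin 3)) (Set.Iio 0) isOpen_Iio) W G ∧
        typeIBound (Set.Iio (0 : ℝ) ×ˢ Set.univ) W p G < ⊤ ∧ HasTypeITimeDecay C W ∧
        (∀ ε : ℝ, 0 < ε → ∀ K₁ : Set (ℝ × EuclideanSpace ℝ (Fin 3)), IsCompact K₁ → K₁ ⊆ Set.Iic (0 : ℝ) ×ˢ Set.univ →
          ∃ L : ℝ, 0 < L ∧ ∀ a : ℝ, ∃ σ ∈ Set.Icc a (a + L),
            MeasureTheory.eLpNorm (fun z : ℝ × EuclideanSpace ℝ (Fin 3) => nsRescale (Real.exp σ) W z.1 z.2 - W z.1 z.2) 3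
              (MeasureTheory.volume.restrict K₁) ≤ ENNReal.ofReal ε) ∧
        IsBackwardSingularPoint W 0)
    (hRL : Summit.NavierStokesRegularity.NavierStokesRegularity.Theses.RecurrentProfiles.RecurrentLiouville) :
    AdaptedFrequencyConverges :=
  AdaptedFrequencyConverges_of_hullForm h1 h2 (stub_recurrentLiouville_iff.2 hRL)

/-- Type-check that the registered stub feeds the load-bearing composition verbatim (the crux, modulo stub 3 =
stmt-1589 alone). -/
theorem AdaptedFrequencyConverges_of_stubs : AdaptedFrequencyConverges :=
  AdaptedFrequencyConverges_of stub_recurrentLiouville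

/-- Type-check of the optional hull-form composition (the crux, modulo the three registered stubs). -/
theorem AdaptedFrequencyConverges_of_hullForm_stubs : AdaptedFrequencyConverges :=
  AdaptedFrequencyConverges_of_hullForm stub_pinchedHullRecurrence stub_recurrentPinchedBridge stub_recurrentLiouville

end Summit.NavierStokesRegularity.NavierStokesRegularity.Cruxes.AdaptedFrequencyConverges.Lines.BirkhoffRecurrentHull

end
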